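import Summits.BirchSwinnertonDyer.BirchSwinnertonDyer.Theorems.ClassRecordThreeEulerHalvesAtThreeCartanUnramifiedShiftEnd
import HarnessLib

/-!
# Kolyvagin's ORDER bound at `p = 3` on the UNRAMIFIED locus, 2/3: the refined order entry and the index form (Cartan road, T2 port)

bsd-idea-10 g9 (ideator, lens = transfer; `--supports stmt-BirchSwinnertonDyer-19109 --as helper`). The tree's D7
`ShimuraKolyvaginOfImage.padicValNat_card_sha_three_primary_add_le_of_shimuraLabels_of_irr_of_casselsTate_of_divLab`
(`…ShimuraInertSavingDisplayOfLabels`) is keyed to the EICHLER locus: every bad prime off the inert set `S` SPLITS in `K`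
(`hsp`) and `3 ∈ S`. On the CARTAN locus of the non-split Cartan road (crux `EulerHalvesAtThree`, child item 23422; workfile
`Cruxes/EulerHalvesAtThree/Lines/cartan_display.lean`, stub `stub_cartanOrderMachineAtThree`) the primes of the Cartan set are
inert and UNRAMIFIED with `q² ∥ N`, so `hsp` fails — but D7's proof chain consumes `hsp` at exactly ONE leaf (the Kodaira–Néron
exponent bound at the multiplicative places off `S`, via «split ⇒ unramified»). This port re-keys the chain to the unramified clause.
Nothing here is new mathematics: every proof is the tree's, re-keyed; CONDITIONAL on `casselsTate_levelInputs K` exactly as D7.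
No summit statement, no route crux and no item is proved by these files.

FILE MAP of the port (three files, ≤ 400 lines each; this is file 2/3):
* 1/3 `…CartanUnramifiedShiftEnd` — §1 the leaf on the unramified locus (`kodairaSymbolAt_and_ordMinimalDiscriminant_baseChange_eq_of_unramified`,
  `padicValNat_ordMinimalDiscriminant_le_of_unramified`: A233 along an unramified place, Silverman VII.5.4 (a), under
  `hunr : ∀ ℓ ∣ N, ℓ ∉ S → ℓ ∤ d_K` instead of the split clause `hsp`) and §2 the unit-index end (`Ш = 0`, `Nat.card` form) of
  `…KolyImageUnitEndShift` VERBATIM with the binder `hsp` replaced by the leaf's CONCLUSION `hbd` (suffix `_of_discBound`);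
* 2/3 `…CartanUnramifiedOrderIndexDiv` — §3 McCallum's refined ORDER entry (`…KolyImageOrderEntryEndShiftDiv` Part Two) and §4 the
  INDEX form (`…KolyImageIndexFormEndDiv`), both VERBATIM with `hsp ↦ hbd` (suffix `_of_discBound`);
* 3/3 `…CartanOrderMachineUnramified` — §5 the image inputs from `Irr E[3]` under «every prime of `N` unramified in `K`» and D7
  re-assembled (`…of_divLab_of_unramified`, binders `hin`, `hunr`, `3 ∤ d_K`), §6 the closed form `cartanOrderMachineAtThree` =
  the statement of `stub_cartanOrderMachineAtThree` of `Cruxes/EulerHalvesAtThree/Lines/cartan_display.lean` VERBATIM, proved.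
[cite: McCallumLMS1991, §1 Theorem (Kolyvagin), §4 Cor. 4.5, Lemma 5.1, Cor. 5.6] [cite: GrossLMS1991, §2, §9 (PDF p. 227), Prop. 9.3, §10]
[cite: SilvermanAEC2009, Prop. VII.5.4 (a), Thm. VII.6.1] [cite: Jetchev2008, Thm. 1.1, (1), Cor. 1.5]
[cite: MilneADT2006, Ch. I Thm. 4.10(b), Thm. 6.13(a)] [cite: NeukirchANT1999, Ch. III Thm. (2.12) and Cor.]
presearch: «Kolyvagin order bound for CM points on Shimura curves with non-split (unramified) level» → [corpus:
book:burns2007-l-functions-galois-representations p0536–p0538 (Nekovář 2007, Thm. 3.2), p0559 (2.6.3)] [galaxy: panama:260103219445847]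
— finiteness in print for any Shimura curve and CM point; the ORDER-with-index form only in the tree (D7, Eichler locus).
beyond-print theorem: no (re-keying of tree proofs).
-/

noncomputable section

open scoped Classical Pointwise AddSubgroup

set_option linter.dupNamespace false

namespace Summit.BirchSwinnertonDyer.BirchSwinnertonDyer.Theorems.ShimuraKolyvaginOfImage

section OrderEntry

open Summit.BirchSwinnertonDyer.BirchSwinnertonDyer.Theorems.ShimuraKolyvaginLocalShift
open WeierstrassCurve NumberField IsDedekindDomain Field Function
  Literature.NumberTheory.EllipticCurves Literature.NumberTheory.EllipticCurves.KolyvaginCocycle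
  Literature.NumberTheory.EllipticCurves.KolyvaginDescent
  Literature.NumberTheory.EllipticCurves.RingClassField
  Literature.NumberTheory.GaloisRepresentations Literature.NumberTheory.GaloisCohomology
  Literature.NumberTheory.NumberFields Literature.NumberTheory.DiophantineGeometry
  Summit.BirchSwinnertonDyer.Rank1Residual.X11b
  Summit.BirchSwinnertonDyer.BirchSwinnertonDyer.Theorems
  Summit.BirchSwinnertonDyer.BirchSwinnertonDyer.Theorems.ShimuraKolyvaginOrder
open Literature.NumberTheory.GaloisRepresentations.DiscreteGaloisModule (mu MuCarrier)

variable {K : Type} [Field K] [NumberField K]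

/-! ### §3 McCallum's refined ORDER entry, keyed to `hbd` (port of `…KolyImageOrderEntryEndShiftDiv` Part Two) -/

/-- **[PORT (bsd-idea-10 g9): the split clause `hsp` of the tree original is REPLACED by the Kodaira–Néron exponent bound `hbd` it was only used to produce; proof otherwise VERBATIM.]** **McCallum 1991 §1 Theorem (Kolyvagin) REFINED BY GLOBAL DIVISIBILITY (Cor. 5.6 with `m ≥ t`; Jetchev 2008 (1)),
ORDER form, for ANY odd prime `p` with the four image inputs, for a Heegner-type Euler system rational over the ring class
fields read one notch deeper whose derived classes are killed by `p^{M−t}`, from Poitou–Tate and the Cassels–Tate inputs**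
— corner3-p2 g5's `card_sha_primary_le_of_ringClassRationalPointsM_shift_of_poitouTate_of_localDuality_ofImage` VERBATIM with
the divisibility conjunct threaded through `hpointsRk` and the conclusion sharpened by `2t` (entry: this file's
`card_sha_primary_le_at_of_pointsMDiv_of_reciprocityFinset_of_localDuality_shift_ofImage`).
[cite: McCallumLMS1991, §1 Theorem (Kolyvagin), Lemma 4.6, Cor. 5.6] [cite: Jetchev2008, p. 812 (1) and Cor. 1.5]
[cite: GrossLMS1991, §2 Thm. 2.2 (2)] [cite: Howard2004Duke, Thm. 3.2.2 (proof)] [cite: MilneADT2006, Ch. I Thm. 4.10(b), §6 Thm. 6.13(a)] -/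
theorem card_sha_primary_le_of_ringClassRationalPointsMDiv_shift_of_poitouTate_of_localDuality_ofImage_of_discBound
    (hPT : poitouTate_sum_localTatePairing_eq_zero K)
    (W : WeierstrassCurve ℚ) [W.IsElliptic] [W.IsGloballyMinimal] {N : ℕ} [NeZero N]
    (hN : W.conductorNorm ℤ = N) {p : ℕ} (hp : p.Prime) (hp2 : p ≠ 2) (hIz : ∃ z : Field.absoluteGaloisGroup K, ∀ t : geomTorsion (W.baseChange K) p, z • t = -t)
    (hIs : (W.baseChange K).HasIrreducibleModPGaloisRep p)
    (hIc : ∀ f : geomTorsion (W.baseChange K) p →+ geomTorsion (W.baseChange K) p,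
      (∀ (g : Field.absoluteGaloisGroup K) (t : geomTorsion (W.baseChange K) p), f (g • t) = g • f t) →
        ∃ k : ℤ, ∀ t, f t = k • t)
    (hIt : AddSubgroup.torsionBy (W.baseChange K).toAffine.Point (p : ℤ) = ⊥)
    (hK : IsImaginaryQuadratic K) (ι : K →+* ℂ) {S : Finset ℕ}
    (hin : ∀ ℓ ∈ S, ℓ.Prime ∧ ℓ ∣ N ∧ ¬ ℓ ^ 2 ∣ N ∧
      ((Ideal.span {(ℓ : ℤ)}).primesOver (𝓞 K)).ncard = 1 ∧ ¬ (ℓ : ℤ) ∣ NumberField.discr K)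
    (hbd : ∀ w : IsDedekindDomain.HeightOneSpectrum (𝓞 K), (W.baseChange K).HasMultiplicativeReductionAt w →
      ((Rat.HeightOneSpectrum.primesEquiv (w.under (𝓞 ℚ)) : ℕ)) ∉ S →
      padicValNat p ((W.baseChange K).ordMinimalDiscriminant w) ≤
        1 + ∑ q ∈ N.primeFactors, padicValNat p (padicValInt q W.minimalDiscriminantInt))
    {P : (W.baseChange K).toAffine.Point} (hnt : ¬ IsOfFinAddOrder P)
    {M₀ : ℕ} (hM₀ : 1 ≤ M₀) [NeZero (p ^ M₀)] {c : K ≃ₐ[ℚ] K} (hc : c ≠ 1) (hcc : c * c = 1)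
    {x₀ : (W.baseChange K).toAffine.Point} (hx₀ : p ^ M₀ • x₀ = P)
    (hmax : ∀ Q : (W.baseChange K).toAffine.Point, p ^ (M₀ + 1) • Q ≠ P)
    (t : ℕ)
    (hpointsRk : ∀ (k : ℕ) {M : ℕ} (_hM : 1 ≤ M)
      (hdiv : ∀ Q : geomPoints (W.baseChange K), ∃ R, ((p ^ M : ℕ) : ℤ) • R = Q)
      (c : K ≃ₐ[ℚ] K) (_hc : c ≠ 1),
      ∃ (ε : ℤ) (τ : AlgebraicClosure K ≃+* AlgebraicClosure K) (hτ : IsLiftOfAut c τ)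
        (A : ℕ → AddSubgroup (geomPoints (W.baseChange K)))
        (hA : ∀ m, KolyvaginCocycle.IsAdmissible (Field.absoluteGaloisGroup K) (A m)
          ((p ^ M : ℕ) : ℤ))
        (emb : ∀ m : ℕ, ringClassField K ι m →ₐ[K] AlgebraicClosure K)
        (Pt : ℕ → geomPoints (W.baseChange K))
        (hPt : ∀ m, Pt m ∈
          KolyvaginCocycle.invPoints (Field.absoluteGaloisGroup K) (A m) ((p ^ M : ℕ) : ℤ)),
        (ε = 1 ∨ ε = -1) ∧
        IsOfFinAddOrder (Affine.Point.map (W' := W) (c : K →ₐ[ℚ] K) P - ε • P) ∧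
        (∀ m, ∀ a ∈ A m, hτ.pointsMap W a ∈ A m) ∧
        Pt 1 = toGeomPoints (W.baseChange K) P ∧
        (∀ m, m ≠ 0 → ∀ a ∈ A m, ∀ Φ : Field.absoluteGaloisGroup K,
          (∀ x : ringClassField K ι m, Φ • emb m x = emb m x) → Φ • a = a) ∧
        (∀ m, KolyvaginCocycle.IsAdmissible (Field.absoluteGaloisGroup K) (A m)
          ((p ^ (M + k) : ℕ) : ℤ)) ∧
        (∀ m : ℕ, Squarefree m →
          (∀ q ∈ m.primeFactors, IsKolyvaginPrime N W K p q ∧ FrobEqFrobInfty W K (p ^ (M + k)) q) →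
          Pt m ∈ KolyvaginCocycle.invPoints (Field.absoluteGaloisGroup K) (A m)
            ((p ^ (M + k) : ℕ) : ℤ) ∧
          (∃ B ∈ A m, hτ.pointsMap W (Pt m) =
            (ε * (-1) ^ m.primeFactors.card) • Pt m + ((p ^ M : ℕ) : ℤ) • B) ∧
          (∀ ℓ : ℕ, ℓ.Prime → ℓ ∣ m → ∀ v : HeightOneSpectrum (𝓞 K), (ℓ : 𝓞 K) ∈ v.asIdeal →
            ∀ a : ℕ, (((p : ℤ) ^ a) •
                kolyvaginClass (W.baseChange K) _ hdiv (hA m) (Pt m) (hPt m) ∈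
                selmerLocalKer (W.baseChange K) (v.adicCompletion K) ((p ^ M : ℕ) : ℤ) ↔
              ((p : ℤ) ^ a) • kolyvaginClass (W.baseChange K) _ hdiv (hA (m / ℓ)) (Pt (m / ℓ))
                  (hPt (m / ℓ)) ∈
                (W.baseChange K).torsionLocalKer (v.adicCompletion K) ((p ^ M : ℕ) : ℤ))) ∧
          -- GLOBAL DIVISIBILITY to depth `t`: the class of `P_m` is killed by `p^{M−t}`
          ((p : ℤ) ^ (M - t)) • kolyvaginClass (W.baseChange K) _ hdiv (hA m) (Pt m) (hPt m) = 0))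
    (e : geomTorsion (W.baseChange K) ((p ^ M₀ * p ^ M₀ : ℕ) : ℤ) →
      geomTorsion (W.baseChange K) ((p ^ M₀ * p ^ M₀ : ℕ) : ℤ) → AlgebraicClosure K)
    (hμ : ∀ S T, e S T ^ (p ^ M₀ * p ^ M₀) = 1)
    (hadd₁ : ∀ S₁ S₂ T, e (S₁ + S₂) T = e S₁ T * e S₂ T)
    (hadd₂ : ∀ S T₁ T₂, e S (T₁ + T₂) = e S T₁ * e S T₂)
    (hgal : ∀ (σ : absoluteGaloisGroup K) (S T : geomTorsion (W.baseChange K) ((p ^ M₀ * p ^ M₀ : ℕ) : ℤ)),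
      σ • e S T = e (σ • S) (σ • T))
    (halt : ∀ T, e T T = 1) (hnondeg : ∀ T, (∀ S, e S T = 1) → T = 0)
    (inv : LocalInvariants K (p ^ M₀ * p ^ M₀)) (hPT' : inv.SumInvLocalizationEqZero)
    (hinv : ∀ v : HeightOneSpectrum (𝓞 K), Injective (inv (Sum.inr v)))
    (hH3 : ∀ x : galoisCohomology (mu K (p ^ M₀ * p ^ M₀)) 3,
      (∀ v : Place K, galoisCohomology.localization (mu K (p ^ M₀ * p ^ M₀)) v 3 x = 0) → x = 0)
    (hB : Literature.GroupTheory.FiniteAbelian.IsLevelPairing (p ^ M₀)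
      (ctLevelPairing (W.baseChange K) (p ^ M₀) e hμ hadd₁ hadd₂ hgal inv halt hPT' hH3
        (localTerm_finite_support (W := W.baseChange K) (m := p ^ M₀) (e := e) (hμ := hμ)
          (hadd₁ := hadd₁) (hadd₂ := hadd₂) (hgal := hgal) halt inv)))
    (hPτ : ∀ z ∈ selmerGroup (W.baseChange K) ((p ^ M₀ * p ^ M₀ : ℕ) : ℤ),
      ∀ t ∈ selmerGroup (W.baseChange K) ((p ^ M₀ * p ^ M₀ : ℕ) : ℤ),
      ctGeneralFun (W.baseChange K) (p ^ M₀) e hμ hadd₁ hadd₂ hgal inv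
          (torsionH1ToH1 (W.baseChange K) _ (conjAct W c _ z))
          (torsionH1ToH1 (W.baseChange K) _ (conjAct W c _ t)) =
        ctGeneralFun (W.baseChange K) (p ^ M₀) e hμ hadd₁ hadd₂ hgal inv
          (torsionH1ToH1 (W.baseChange K) _ z) (torsionH1ToH1 (W.baseChange K) _ t)) :
    Finite (AddCommGroup.primaryComponent (W.baseChange K).sha p) ∧
    (∀ c ∈ AddCommGroup.primaryComponent (W.baseChange K).sha p, p ^ M₀ • c = 0) ∧
    Nat.card (AddCommGroup.primaryComponent (W.baseChange K).sha p) ≤ p ^ (2 * (M₀ - t)) ∧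
    padicValNat p (Nat.card (AddCommGroup.primaryComponent (W.baseChange K).sha p)) + 2 * t ≤
      2 * M₀ := by
  haveI : (W.baseChange K).IsElliptic := inferInstanceAs (W.map (algebraMap ℚ K)).IsElliptic
  -- the depth `k₀` absorbing the `p`-parts of all Kodaira–Néron exponents on the locus
  set k₀ : ℕ := 1 + ∑ q ∈ N.primeFactors, padicValNat p (padicValInt q W.minimalDiscriminantInt) with hk₀
  have hk1 : 1 ≤ k₀ := Nat.le_add_right 1 _
  have hkm : ∀ w : HeightOneSpectrum (𝓞 K), (W.baseChange K).HasMultiplicativeReductionAt w →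
      ((Rat.HeightOneSpectrum.primesEquiv (w.under (𝓞 ℚ)) : ℕ)) ∉ S →
      padicValNat p ((W.baseChange K).ordMinimalDiscriminant w) ≤ k₀ := fun w hmw hℓS ↦
    hbd w hmw hℓS
  refine card_sha_primary_le_at_of_pointsMDiv_of_reciprocityFinset_of_localDuality_shift_ofImage W hK hN k₀ hnt hp hp2 hIz hIs hIc
    hIt hM₀ hc hcc hx₀ hmax t ?_
    (@fun _ hM _ hℓ _ ↦ kolyvaginReciprocityFinset_of_poitouTate_of_conductorNorm W hN hPT hp hM hℓ)
    e hμ hadd₁ hadd₂ hgal halt hnondeg inv hPT' hinv hH3 hB hPτ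
  intro M hM hdiv c₁ hc₁
  obtain ⟨ε, τ, hτ, A, hA, emb, Pt, hPt, hε, h53, hAτ, hPt1, hrat, hAk, hm'⟩ := hpointsRk k₀ hM hdiv c₁ hc₁
  refine ⟨ε, τ, hτ, A, hA, Pt, hPt, hε, h53, hAτ, hPt1, fun m hm hk ↦
    ⟨(hm' m hm hk).2.1, ?_, (hm' m hm hk).2.2.1, (hm' m hm hk).2.2.2⟩⟩
  intro v hv
  have hm0 : m ≠ 0 := Squarefree.ne_zero hm
  exact kolyvaginClass_mem_selmerLocalKer_of_ringClassRational_shift hK ι hm0 (emb m) W hp hp2 hin hk1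
    hkm (fun q hq ↦ (hk q hq).1.2.1) (hA m) (hAk m) (hrat m hm0) (hPt m) ((hm' m hm hk).1) v hv

end OrderEntry

section IndexForm

open Summit.BirchSwinnertonDyer.BirchSwinnertonDyer.Theorems.ShimuraKolyvaginLocalShift
open WeierstrassCurve NumberField IsDedekindDomain Field Function
  Literature.NumberTheory.EllipticCurves Literature.NumberTheory.EllipticCurves.KolyvaginCocycle
  Literature.NumberTheory.EllipticCurves.KolyvaginDescent
  Literature.NumberTheory.EllipticCurves.RingClassField
  Literature.NumberTheory.GaloisRepresentations Literature.NumberTheory.GaloisCohomology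
  Literature.NumberTheory.NumberFields Literature.NumberTheory.DiophantineGeometry
  Summit.BirchSwinnertonDyer.Rank1Residual.X11b
  Summit.BirchSwinnertonDyer.BirchSwinnertonDyer.Theorems
  Summit.BirchSwinnertonDyer.BirchSwinnertonDyer.Theorems.ShimuraKolyvaginOrder
open Literature.NumberTheory.GaloisRepresentations.DiscreteGaloisModule (mu MuCarrier)

variable {K : Type} [Field K] [NumberField K]

/-! ### §4 The INDEX form refined by global divisibility, keyed to `hbd` (port of `…KolyImageIndexFormEndDiv`) -/

/-- **[PORT (bsd-idea-10 g9): the split clause `hsp` of the tree original is REPLACED by the Kodaira–Néron exponent bound `hbd` it was only used to produce; proof otherwise VERBATIM.]** **INDEX form, `p` odd, image inputs, REFINED BY GLOBAL DIVISIBILITY: `ord_p #Ш(E/K)[p^∞] + 2t ≤ 2·ord_p[E(K):ℤP]`** for a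
point `P` of finite index carrying the depth-`k` ring-class-rational Euler system `hpointsRk` WHOSE DERIVED CLASSES ARE KILLED
BY `p^{M−t}` (the divisibility conjunct of D4), from Poitou–Tate and the Cassels–Tate inputs at level `p^{M₀}`,
`M₀ = ord_p[E(K):ℤP]` — corner3-p2 g5's `natCard_sha_primary_le_pow_index_of_ringClassRationalPointsM_shift_…_ofImage`
(`…KolyImageIndexFormGenericEnd.lean`) with the divisibility threaded: `M₀ ≥ 1` is D4's
`card_sha_primary_le_of_ringClassRationalPointsMDiv_shift_of_poitouTate_of_localDuality_ofImage` after McCallum's Lemma 5.1;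
`M₀ = 0` is the parents' END (`Ш(E/K)[p^∞] = 0`) together with `t = 0`, read off the divisibility at `m = 1`, level `p`
(`δ_p P = 0 ⟹ P ∈ pE(K)`, `kummerMapTorsion_ker`, contradicting `p ∤ [E(K):ℤP]`). NO clause on `E`.
[cite: McCallumLMS1991, §1 Theorem (Kolyvagin), Lemma 5.1, Cor. 5.6] [cite: Jetchev2008, p. 812 (1) and Cor. 1.5]
[cite: GrossLMS1991, §2 Thm. 2.2 (2)] [cite: MilneADT2006, Ch. I Thm. 4.10(b), §6 Thm. 6.13(a)] -/
theorem padicValNat_card_sha_primary_add_le_of_ringClassRationalPointsMDiv_shift_of_poitouTate_of_localDuality_ofImage_of_discBound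
    (hPT : poitouTate_sum_localTatePairing_eq_zero K)
    (W : WeierstrassCurve ℚ) [W.IsElliptic] [W.IsGloballyMinimal] {N : ℕ} [NeZero N]
    (hN : W.conductorNorm ℤ = N) {p : ℕ} [Fact p.Prime] (hp2 : p ≠ 2) (hIz : ∃ z : Field.absoluteGaloisGroup K, ∀ t : geomTorsion (W.baseChange K) p, z • t = -t)
    (hIs : (W.baseChange K).HasIrreducibleModPGaloisRep p)
    (hIc : ∀ f : geomTorsion (W.baseChange K) p →+ geomTorsion (W.baseChange K) p,
      (∀ (g : Field.absoluteGaloisGroup K) (t : geomTorsion (W.baseChange K) p), f (g • t) = g • f t) →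
        ∃ k : ℤ, ∀ t, f t = k • t)
    (hIt : AddSubgroup.torsionBy (W.baseChange K).toAffine.Point (p : ℤ) = ⊥)
    (hK : IsImaginaryQuadratic K)
    (ι : K →+* ℂ) {S : Finset ℕ}
    (hin : ∀ ℓ ∈ S, ℓ.Prime ∧ ℓ ∣ N ∧ ¬ ℓ ^ 2 ∣ N ∧
      ((Ideal.span {(ℓ : ℤ)}).primesOver (𝓞 K)).ncard = 1 ∧ ¬ (ℓ : ℤ) ∣ NumberField.discr K)
    (hbd : ∀ w : IsDedekindDomain.HeightOneSpectrum (𝓞 K), (W.baseChange K).HasMultiplicativeReductionAt w →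
      ((Rat.HeightOneSpectrum.primesEquiv (w.under (𝓞 ℚ)) : ℕ)) ∉ S →
      padicValNat p ((W.baseChange K).ordMinimalDiscriminant w) ≤
        1 + ∑ q ∈ N.primeFactors, padicValNat p (padicValInt q W.minimalDiscriminantInt))
    {P : (W.baseChange K).toAffine.Point} (hnt : ¬ IsOfFinAddOrder P)
    (hidx0 : 0 < (AddSubgroup.zmultiples P).index) {M₀ : ℕ}
    (hv : padicValNat p (AddSubgroup.zmultiples P).index = M₀) [NeZero (p ^ M₀)]
    {c : K ≃ₐ[ℚ] K} (hc : c ≠ 1) (hcc : c * c = 1)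
    (t : ℕ)
    (hpointsRk : ∀ (k : ℕ) {M : ℕ} (_hM : 1 ≤ M)
      (hdiv : ∀ Q : geomPoints (W.baseChange K), ∃ R, ((p ^ M : ℕ) : ℤ) • R = Q)
      (c : K ≃ₐ[ℚ] K) (_hc : c ≠ 1),
      ∃ (ε : ℤ) (τ : AlgebraicClosure K ≃+* AlgebraicClosure K) (hτ : IsLiftOfAut c τ)
        (A : ℕ → AddSubgroup (geomPoints (W.baseChange K)))
        (hA : ∀ m, KolyvaginCocycle.IsAdmissible (Field.absoluteGaloisGroup K) (A m)
          ((p ^ M : ℕ) : ℤ))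
        (emb : ∀ m : ℕ, ringClassField K ι m →ₐ[K] AlgebraicClosure K)
        (Pt : ℕ → geomPoints (W.baseChange K))
        (hPt : ∀ m, Pt m ∈
          KolyvaginCocycle.invPoints (Field.absoluteGaloisGroup K) (A m) ((p ^ M : ℕ) : ℤ)),
        (ε = 1 ∨ ε = -1) ∧
        IsOfFinAddOrder (Affine.Point.map (W' := W) (c : K →ₐ[ℚ] K) P - ε • P) ∧
        (∀ m, ∀ a ∈ A m, hτ.pointsMap W a ∈ A m) ∧
        Pt 1 = toGeomPoints (W.baseChange K) P ∧
        (∀ m, m ≠ 0 → ∀ a ∈ A m, ∀ Φ : Field.absoluteGaloisGroup K,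
          (∀ x : ringClassField K ι m, Φ • emb m x = emb m x) → Φ • a = a) ∧
        (∀ m, KolyvaginCocycle.IsAdmissible (Field.absoluteGaloisGroup K) (A m)
          ((p ^ (M + k) : ℕ) : ℤ)) ∧
        (∀ m : ℕ, Squarefree m →
          (∀ q ∈ m.primeFactors, IsKolyvaginPrime N W K p q ∧ FrobEqFrobInfty W K (p ^ (M + k)) q) →
          Pt m ∈ KolyvaginCocycle.invPoints (Field.absoluteGaloisGroup K) (A m)
            ((p ^ (M + k) : ℕ) : ℤ) ∧
          (∃ B ∈ A m, hτ.pointsMap W (Pt m) =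
            (ε * (-1) ^ m.primeFactors.card) • Pt m + ((p ^ M : ℕ) : ℤ) • B) ∧
          (∀ ℓ : ℕ, ℓ.Prime → ℓ ∣ m → ∀ v : HeightOneSpectrum (𝓞 K), (ℓ : 𝓞 K) ∈ v.asIdeal →
            ∀ a : ℕ, (((p : ℤ) ^ a) •
                kolyvaginClass (W.baseChange K) _ hdiv (hA m) (Pt m) (hPt m) ∈
                selmerLocalKer (W.baseChange K) (v.adicCompletion K) ((p ^ M : ℕ) : ℤ) ↔
              ((p : ℤ) ^ a) • kolyvaginClass (W.baseChange K) _ hdiv (hA (m / ℓ)) (Pt (m / ℓ))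
                  (hPt (m / ℓ)) ∈
                (W.baseChange K).torsionLocalKer (v.adicCompletion K) ((p ^ M : ℕ) : ℤ))) ∧
          -- GLOBAL DIVISIBILITY to depth `t`: the class of `P_m` is killed by `p^{M−t}`
          ((p : ℤ) ^ (M - t)) • kolyvaginClass (W.baseChange K) _ hdiv (hA m) (Pt m) (hPt m) = 0))
    (e : geomTorsion (W.baseChange K) ((p ^ M₀ * p ^ M₀ : ℕ) : ℤ) →
      geomTorsion (W.baseChange K) ((p ^ M₀ * p ^ M₀ : ℕ) : ℤ) → AlgebraicClosure K)
    (hμ : ∀ S T, e S T ^ (p ^ M₀ * p ^ M₀) = 1)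
    (hadd₁ : ∀ S₁ S₂ T, e (S₁ + S₂) T = e S₁ T * e S₂ T)
    (hadd₂ : ∀ S T₁ T₂, e S (T₁ + T₂) = e S T₁ * e S T₂)
    (hgal : ∀ (σ : absoluteGaloisGroup K) (S T : geomTorsion (W.baseChange K) ((p ^ M₀ * p ^ M₀ : ℕ) : ℤ)),
      σ • e S T = e (σ • S) (σ • T))
    (halt : ∀ T, e T T = 1) (hnondeg : ∀ T, (∀ S, e S T = 1) → T = 0)
    (inv : LocalInvariants K (p ^ M₀ * p ^ M₀)) (hPT' : inv.SumInvLocalizationEqZero)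
    (hinv : ∀ v : HeightOneSpectrum (𝓞 K), Injective (inv (Sum.inr v)))
    (hH3 : ∀ x : galoisCohomology (mu K (p ^ M₀ * p ^ M₀)) 3,
      (∀ v : Place K, galoisCohomology.localization (mu K (p ^ M₀ * p ^ M₀)) v 3 x = 0) → x = 0)
    (hB : Literature.GroupTheory.FiniteAbelian.IsLevelPairing (p ^ M₀)
      (ctLevelPairing (W.baseChange K) (p ^ M₀) e hμ hadd₁ hadd₂ hgal inv halt hPT' hH3
        (localTerm_finite_support (W := W.baseChange K) (m := p ^ M₀) (e := e) (hμ := hμ)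
          (hadd₁ := hadd₁) (hadd₂ := hadd₂) (hgal := hgal) halt inv)))
    (hPτ : ∀ z ∈ selmerGroup (W.baseChange K) ((p ^ M₀ * p ^ M₀ : ℕ) : ℤ),
      ∀ t ∈ selmerGroup (W.baseChange K) ((p ^ M₀ * p ^ M₀ : ℕ) : ℤ),
      ctGeneralFun (W.baseChange K) (p ^ M₀) e hμ hadd₁ hadd₂ hgal inv
          (torsionH1ToH1 (W.baseChange K) _ (conjAct W c _ z))
          (torsionH1ToH1 (W.baseChange K) _ (conjAct W c _ t)) =
        ctGeneralFun (W.baseChange K) (p ^ M₀) e hμ hadd₁ hadd₂ hgal inv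
          (torsionH1ToH1 (W.baseChange K) _ z) (torsionH1ToH1 (W.baseChange K) _ t)) :
    padicValNat p (Nat.card (AddCommGroup.primaryComponent (W.baseChange K).sha p)) + 2 * t ≤
      2 * padicValNat p (AddSubgroup.zmultiples P).index := by
  haveI : (W.baseChange K).IsElliptic := inferInstanceAs (W.map (algebraMap ℚ K)).IsElliptic
  have hp : p.Prime := Fact.out
  -- `E(K)[p] = 0`
  have hbot := hIt
  have hAp : ∀ a : (W.baseChange K).toAffine.Point, ((p : ℕ) : ℤ) • a = 0 → a = 0 := fun a ha ↦ by
    have : a ∈ AddSubgroup.torsionBy (W.baseChange K).toAffine.Point ((p : ℕ) : ℤ) := by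
      rw [mem_torsionBy_iff]; exact ha
    rw [hbot] at this
    exact this
  -- McCallum Lemma 5.1: `ord_p [E(K) : ℤP] = M₀ ⟺ p^{M₀} ∥ P`
  obtain ⟨⟨x₀, hx₀⟩, hmax'⟩ :=
    Summit.BirchSwinnertonDyer.Rank1Residual.Additive.zsmul_certificate_of_padicValNat_index hp
      hAp hnt hidx0.ne' hv
  -- the unrefined carrier (drop the divisibility conjunct), for the `M₀ = 0` END
  have hpointsRk' : ∀ (k : ℕ) {M : ℕ} (_hM : 1 ≤ M)
      (hdiv : ∀ Q : geomPoints (W.baseChange K), ∃ R, ((p ^ M : ℕ) : ℤ) • R = Q)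
      (c : K ≃ₐ[ℚ] K) (_hc : c ≠ 1),
      ∃ (ε : ℤ) (τ : AlgebraicClosure K ≃+* AlgebraicClosure K) (hτ : IsLiftOfAut c τ)
        (A : ℕ → AddSubgroup (geomPoints (W.baseChange K)))
        (hA : ∀ m, KolyvaginCocycle.IsAdmissible (Field.absoluteGaloisGroup K) (A m)
          ((p ^ M : ℕ) : ℤ))
        (emb : ∀ m : ℕ, ringClassField K ι m →ₐ[K] AlgebraicClosure K)
        (Pt : ℕ → geomPoints (W.baseChange K))
        (hPt : ∀ m, Pt m ∈
          KolyvaginCocycle.invPoints (Field.absoluteGaloisGroup K) (A m) ((p ^ M : ℕ) : ℤ)),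
        (ε = 1 ∨ ε = -1) ∧
        IsOfFinAddOrder (Affine.Point.map (W' := W) (c : K →ₐ[ℚ] K) P - ε • P) ∧
        (∀ m, ∀ a ∈ A m, hτ.pointsMap W a ∈ A m) ∧
        Pt 1 = toGeomPoints (W.baseChange K) P ∧
        (∀ m, m ≠ 0 → ∀ a ∈ A m, ∀ Φ : Field.absoluteGaloisGroup K,
          (∀ x : ringClassField K ι m, Φ • emb m x = emb m x) → Φ • a = a) ∧
        (∀ m, KolyvaginCocycle.IsAdmissible (Field.absoluteGaloisGroup K) (A m)
          ((p ^ (M + k) : ℕ) : ℤ)) ∧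
        (∀ m : ℕ, Squarefree m →
          (∀ q ∈ m.primeFactors, IsKolyvaginPrime N W K p q ∧ FrobEqFrobInfty W K (p ^ (M + k)) q) →
          Pt m ∈ KolyvaginCocycle.invPoints (Field.absoluteGaloisGroup K) (A m)
            ((p ^ (M + k) : ℕ) : ℤ) ∧
          (∃ B ∈ A m, hτ.pointsMap W (Pt m) =
            (ε * (-1) ^ m.primeFactors.card) • Pt m + ((p ^ M : ℕ) : ℤ) • B) ∧
          (∀ ℓ : ℕ, ℓ.Prime → ℓ ∣ m → ∀ v : HeightOneSpectrum (𝓞 K), (ℓ : 𝓞 K) ∈ v.asIdeal →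
            ∀ a : ℕ, (((p : ℤ) ^ a) •
                kolyvaginClass (W.baseChange K) _ hdiv (hA m) (Pt m) (hPt m) ∈
                selmerLocalKer (W.baseChange K) (v.adicCompletion K) ((p ^ M : ℕ) : ℤ) ↔
              ((p : ℤ) ^ a) • kolyvaginClass (W.baseChange K) _ hdiv (hA (m / ℓ)) (Pt (m / ℓ))
                  (hPt (m / ℓ)) ∈
                (W.baseChange K).torsionLocalKer (v.adicCompletion K) ((p ^ M : ℕ) : ℤ)))) := by
    intro k M hM hdiv c hc
    obtain ⟨ε, τ, hτ, A, hA, emb, Pt, hPt, hε, h53, hAτ, hPt1, hrat, hAk, hm'⟩ := hpointsRk k hM hdiv c hc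
    exact ⟨ε, τ, hτ, A, hA, emb, Pt, hPt, hε, h53, hAτ, hPt1, hrat, hAk, fun m hm hk ↦
      ⟨(hm' m hm hk).1, (hm' m hm hk).2.1, (hm' m hm hk).2.2.1⟩⟩
  rcases Nat.eq_zero_or_pos M₀ with h0 | hpos
  · -- `M₀ = 0`: `Ш(E/K)[p^∞] = 0` by the parents' END, and `t = 0` by the divisibility at `m = 1`, level `p`
    subst h0
    have hcard := natCard_primaryComponent_sha_le_of_ringClassRationalPointsM_shift_of_poitouTate_ofImage_of_discBound hPT W hN hp2
      hIz hIs hIc hIt hK ι hin hbd hnt hidx0 hv hpointsRk'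
    rw [hv, mul_zero, pow_zero] at hcard
    have hv0 : padicValNat p (Nat.card (AddCommGroup.primaryComponent (W.baseChange K).sha p)) = 0 := by
      rw [padicValNat.eq_zero_iff]
      rcases Nat.le_one_iff_eq_zero_or_eq_one.mp hcard with h | h
      · exact Or.inr (Or.inl h)
      · exact Or.inr (Or.inr (by rw [h]; exact fun hd ↦ hp.one_lt.ne' (Nat.dvd_one.mp hd)))
    -- `t = 0`
    have ht : t = 0 := by
      by_contra ht0
      have hdiv1 : ∀ Q : geomPoints (W.baseChange K), ∃ R, ((p ^ 1 : ℕ) : ℤ) • R = Q := fun Q ↦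
        (W.baseChange K).zsmul_geomPoints_surjective_holds (by exact_mod_cast pow_ne_zero 1 hp.ne_zero) Q
      obtain ⟨ε, τ, hτ, A, hA, emb, Pt, hPt, -, -, -, hPt1, -, -, hm'⟩ := hpointsRk 0 le_rfl hdiv1 c hc
      have h1 := (hm' 1 squarefree_one (by simp)).2.2.2
      rw [show 1 - t = 0 by omega, pow_zero, one_smul] at h1
      have hP1 : toGeomPoints (W.baseChange K) P ∈
          KolyvaginCocycle.invPoints (Field.absoluteGaloisGroup K) (A 1) ((p ^ 1 : ℕ) : ℤ) := by
        rw [← hPt1]; exact hPt 1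
      rw [kolyvaginClass_congr_point (hA 1) (hP' := hP1) hPt1, kolyvaginClass_toGeomPoints (hA 1) P hP1] at h1
      have hker : P ∈ (kummerMapTorsion (W.baseChange K) _ hdiv1).ker := by
        rw [AddMonoidHom.mem_ker, h1]
      rw [kummerMapTorsion_ker, AddMonoidHom.mem_range] at hker
      obtain ⟨z, hz⟩ := hker
      exact hmax' ⟨z, hz⟩
    rw [hv, ht, hv0]
  have hx₀' : p ^ M₀ • x₀ = P := by rw [← natCast_zsmul]; exact hx₀
  have hmax : ∀ Q : (W.baseChange K).toAffine.Point, p ^ (M₀ + 1) • Q ≠ P := fun Q hQ ↦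
    hmax' ⟨Q, by rw [natCast_zsmul]; exact hQ⟩
  rw [hv]
  exact (card_sha_primary_le_of_ringClassRationalPointsMDiv_shift_of_poitouTate_of_localDuality_ofImage_of_discBound hPT W hN hp
    hp2 hIz hIs hIc hIt hK ι hin hbd hnt hpos hc hcc hx₀' hmax t hpointsRk e hμ hadd₁ hadd₂ hgal halt hnondeg inv hPT'
    hinv hH3 hB hPτ).2.2.2

end IndexForm

end Summit.BirchSwinnertonDyer.BirchSwinnertonDyer.Theorems.ShimuraKolyvaginOfImage

end
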